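import Mathlib
import HarnessLib.Audit
import Summits.PneNP.PneNP.Theorems.PstarReaderCore

/-!
# Reader substitution, system level: feasibility and minimality pass to the core (ROUND-24, preprocessing for `|W| ≥ 2`)

FRONTIER range-avoidance ladder, rung F-N3, ROUND 24 (cell `pnp-ideate`; restricted-model proof complexity — nothing here bears
on `P` versus `NP`).

Sequel of `PstarReaderCore`.  A G-CONSTRAINT SYSTEM is a finite set of triples `(C, G, b)` read `gval I C G z = b`; a
parity system `W` is the case `G = ∅` (`ofParity`, `gholds_ofParity_iff`).  For a set `R ⊆ J` of readers of `J` (both XOR slots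
`J`-private) and a system whose monomial sets avoid `R`, substituting the readers (`subW`) gives:

* `solves_iff_core` — `J` is solvable together with the system iff the CORE `J ∖ R` is solvable together with the substituted system
  (memo ROUND-24-PRESEED §13 R10(q)(b): "a reader is substituted out of every constraint through one of its tips — `C ← C △ {t,t'}`,
  `G += g` — … `h` unchanged, `#J` drops");
* for the crux format (`PstarGapLemma.MinInfeasible I y W J`, `W` a parity system): `feasible_iff_core`; the core stays minimal
  (`core_erase_solvable`: deleting a core output makes the substituted system solvable on the rest of the core); deleting a READER
  flips exactly the substituted constraints that read its second tip (`reader_flip`), and every reader's second tip is read by some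
  constraint of `W` (`reader_is_read`) — "minimality is automatic for readers" (memo R10(v)).

So after this preprocessing a minimal infeasible `(J, W)` with `|W| = h` is a core without readers, minimal infeasible under `h`
G-constraints whose monomials are the substituted readers — the starting point of the planner's T24.18 analysis.
-/

set_option linter.dupNamespace false

open Finset Literature.Computability.Complexity
open Summit.PneNP.PneNP.Theorems.PstarPDT (parity)
open Summit.PneNP.PneNP.Theorems.PstarTyped (Typed)
open Summit.PneNP.PneNP.Theorems.PstarSALevel (varSet)
open Summit.PneNP.PneNP.Theorems.PstarGapLemma (Sat Feasible MinInfeasible)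
open Summit.PneNP.PneNP.Theorems.PstarGapOneAll (gval gval_empty)
open Summit.PneNP.PneNP.Theorems.PstarGapTwoReaders (IsReader)
open Summit.PneNP.PneNP.Theorems.PstarReaderCore

namespace Summit.PneNP.PneNP.Theorems.PstarReaderCoreSystem

variable {n m : ℕ}

/-! ## G-constraint systems -/

/-- A parity constraint as a G-constraint (no monomials). -/
def ofParity (m : ℕ) (w : Finset (Fin n) × Bool) : Finset (Fin n) × Finset (Fin m) × Bool := (w.1, ∅, w.2)

/-- The substituted constraint (readers of `R` solved for their second tips). -/
def subW (I : LocalMap 4 n m) (R : Finset (Fin m)) (y : Fin m → Bool) (w : Finset (Fin n) × Finset (Fin m) × Bool) :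
    Finset (Fin n) × Finset (Fin m) × Bool :=
  (subC I R w.1, subG I R w.1 w.2.1, subb I R y w.1 w.2.2)

/-- A parity system holds iff its G-form holds. -/
theorem gholds_ofParity_iff (I : LocalMap 4 n m) (W : Finset (Finset (Fin n) × Bool)) (z : Fin n → Bool) :
    (∀ w ∈ W.image (ofParity m), gval I w.1 w.2.1 z = w.2.2) ↔ Sat W z := by
  classical
  unfold PstarGapLemma.Sat
  constructor
  · intro h w hw
    have := h _ (mem_image_of_mem _ hw)
    simpa [ofParity, gval_empty] using this
  · intro h w' hw'
    obtain ⟨w, hw, rfl⟩ := mem_image.1 hw'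
    simpa [ofParity, gval_empty] using h w hw

section Core

variable (I : LocalMap 4 n m) (hI : I.IsPure xorAndPred) (hT : Typed I) {J R : Finset (Fin m)} (hRJ : R ⊆ J)
  (hR : ∀ g ∈ R, IsReader I J g) (y : Fin m → Bool)

include hI hRJ hR in
/-- On a solution of the readers, the substituted system holds iff the original system holds. -/
theorem gholds_sub_iff_of_solves (𝒲 : Finset (Finset (Fin n) × Finset (Fin m) × Bool)) (h𝒲 : ∀ w ∈ 𝒲, Disjoint w.2.1 R)
    {z : Fin n → Bool} (hz : ∀ g ∈ R, I.eval z g = y g) : (∀ w ∈ 𝒲.image (subW I R y), gval I w.1 w.2.1 z = w.2.2) ↔ ∀ w ∈ 𝒲, gval I w.1 w.2.1 z = w.2.2 := by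
  classical
  constructor
  · intro h w hw
    have := h _ (mem_image_of_mem _ hw)
    exact (gval_sub_iff_of_solves I hI hRJ hR y w.1 (h𝒲 w hw) w.2.2 hz).1 this
  · intro h w' hw'
    obtain ⟨w, hw, rfl⟩ := mem_image.1 hw'
    exact (gval_sub_iff_of_solves I hI hRJ hR y w.1 (h𝒲 w hw) w.2.2 hz).2 (h w hw)

include hI hT hRJ hR in
/-- Substituted systems do not read second tips of `R`. -/
theorem gholds_sub_congr (𝒲 : Finset (Finset (Fin n) × Finset (Fin m) × Bool)) {z z' : Fin n → Bool}
    (h : ∀ v, (∀ g ∈ R, I.vars g 1 ≠ v) → z v = z' v) :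
    (∀ w ∈ 𝒲.image (subW I R y), gval I w.1 w.2.1 z = w.2.2) ↔ ∀ w ∈ 𝒲.image (subW I R y), gval I w.1 w.2.1 z' = w.2.2 := by
  classical
  constructor
  · intro hz w' hw'
    obtain ⟨w, -, rfl⟩ := mem_image.1 hw'
    have := hz _ hw'
    unfold subW at this ⊢
    rwa [gval_sub_congr I hI hT hRJ hR w.1 w.2.1 h] at this
  · intro hz w' hw'
    obtain ⟨w, -, rfl⟩ := mem_image.1 hw'
    have := hz _ hw'
    unfold subW at this ⊢
    rwa [gval_sub_congr I hI hT hRJ hR w.1 w.2.1 h]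

include hI hT hRJ hR in
/-- **Feasibility passes to the core**: `J` is solvable together with the system iff `J ∖ R` is solvable together with the
substituted system. -/
theorem solves_iff_core (𝒲 : Finset (Finset (Fin n) × Finset (Fin m) × Bool)) (h𝒲 : ∀ w ∈ 𝒲, Disjoint w.2.1 R) :
    (∃ z : Fin n → Bool, (∀ j ∈ J, I.eval z j = y j) ∧ ∀ w ∈ 𝒲, gval I w.1 w.2.1 z = w.2.2) ↔
      ∃ z : Fin n → Bool, (∀ j ∈ J \ R, I.eval z j = y j) ∧ ∀ w ∈ 𝒲.image (subW I R y), gval I w.1 w.2.1 z = w.2.2 := by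
  constructor
  · rintro ⟨z, hzJ, hz𝒲⟩
    exact ⟨z, fun j hj => hzJ j (mem_sdiff.1 hj).1,
      (gholds_sub_iff_of_solves I hI hRJ hR y 𝒲 h𝒲 fun g hg => hzJ g (hRJ hg)).2 hz𝒲⟩
  · rintro ⟨z, hzJ, hz𝒲⟩
    obtain ⟨z', hz'R, hz'off, hz'J⟩ := exists_fix_readers I hI hT hRJ hR y z
    refine ⟨z', fun j hj => ?_, ?_⟩
    · by_cases hjR : j ∈ R
      · exact hz'R j hjR
      · rw [hz'J j hj hjR]; exact hzJ j (mem_sdiff.2 ⟨hj, hjR⟩)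
    · have h1 : ∀ w ∈ 𝒲.image (subW I R y), gval I w.1 w.2.1 z' = w.2.2 := (gholds_sub_congr I hI hT hRJ hR y 𝒲 hz'off).2 hz𝒲
      exact (gholds_sub_iff_of_solves I hI hRJ hR y 𝒲 h𝒲 hz'R).1 h1

/-! ## The crux format: parity systems and minimal infeasibility -/

include hI hT hRJ hR in
/-- **`W`-feasibility of `J` = solvability of the core under the substituted parities.** -/
theorem feasible_iff_core (W : Finset (Finset (Fin n) × Bool)) :
    Feasible I y W J ↔ ∃ z : Fin n → Bool, (∀ j ∈ J \ R, I.eval z j = y j) ∧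
      ∀ w ∈ (W.image (ofParity m)).image (subW I R y), gval I w.1 w.2.1 z = w.2.2 := by
  classical
  have h𝒲 : ∀ w ∈ W.image (ofParity m), Disjoint w.2.1 R := by
    intro w hw
    obtain ⟨w₀, -, rfl⟩ := mem_image.1 hw
    exact disjoint_empty_left _
  rw [← solves_iff_core I hI hT hRJ hR y _ h𝒲]
  unfold PstarGapLemma.Feasible
  constructor
  · rintro ⟨z, hzW, hzJ⟩; exact ⟨z, hzJ, (gholds_ofParity_iff I W z).2 hzW⟩
  · rintro ⟨z, hzJ, hzW⟩; exact ⟨z, (gholds_ofParity_iff I W z).1 hzW, hzJ⟩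

include hI hT hRJ hR in
/-- **The core is infeasible** under the substituted parities when `J` is `W`-infeasible. -/
theorem core_not_solvable {W : Finset (Finset (Fin n) × Bool)} (hmin : MinInfeasible I y W J) :
    ¬ ∃ z : Fin n → Bool, (∀ j ∈ J \ R, I.eval z j = y j) ∧
      ∀ w ∈ (W.image (ofParity m)).image (subW I R y), gval I w.1 w.2.1 z = w.2.2 :=
  fun h => hmin.1 ((feasible_iff_core I hI hT hRJ hR y W).2 h)

include hI hRJ hR in
/-- **The core stays minimal**: deleting a core output leaves the rest of the core solvable under the substituted parities. -/
theorem core_erase_solvable {W : Finset (Finset (Fin n) × Bool)} (hmin : MinInfeasible I y W J) {j : Fin m} (hj : j ∈ J \ R) :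
    ∃ z : Fin n → Bool, (∀ j' ∈ (J \ R).erase j, I.eval z j' = y j') ∧
      ∀ w ∈ (W.image (ofParity m)).image (subW I R y), gval I w.1 w.2.1 z = w.2.2 := by
  classical
  obtain ⟨z, hzW, hzJ⟩ := hmin.2 j (mem_sdiff.1 hj).1
  have h𝒲 : ∀ w ∈ W.image (ofParity m), Disjoint w.2.1 R := by
    intro w hw
    obtain ⟨w₀, -, rfl⟩ := mem_image.1 hw
    exact disjoint_empty_left _
  refine ⟨z, fun j' hj' => hzJ j' (mem_erase.2 ⟨ne_of_mem_erase hj', (mem_sdiff.1 (mem_of_mem_erase hj')).1⟩), ?_⟩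
  have hzR : ∀ g ∈ R, I.eval z g = y g := fun g hg =>
    hzJ g (mem_erase.2 ⟨fun h => (mem_sdiff.1 hj).2 (h ▸ hg), hRJ hg⟩)
  exact (gholds_sub_iff_of_solves I hI hRJ hR y _ h𝒲 hzR).2 ((gholds_ofParity_iff I W z).2 hzW)

include hI hRJ hR in
/-- **Deleting a reader flips exactly the constraints reading its second tip**: minimality at a reader `g ∈ R` provides an
assignment solving `J ∖ {g}`, violating `g`, satisfying `W`, on which the substituted parity of `(C, b)` holds iff `t'_g ∉ C`. -/
theorem reader_flip {W : Finset (Finset (Fin n) × Bool)} (hmin : MinInfeasible I y W J) {g : Fin m} (hg : g ∈ R) :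
    ∃ z : Fin n → Bool, (∀ j ∈ J, j ≠ g → I.eval z j = y j) ∧ I.eval z g ≠ y g ∧
      ∀ w ∈ W, (gval I (subC I R w.1) (subG I R w.1 ∅) z = subb I R y w.1 w.2 ↔ I.vars g 1 ∉ w.1) := by
  classical
  obtain ⟨z, hzW, hzJ⟩ := hmin.2 g (hRJ hg)
  have hviol : I.eval z g ≠ y g := by
    intro h
    exact hmin.1 ⟨z, hzW, fun j hj => if hjg : j = g then hjg ▸ h else hzJ j (mem_erase.2 ⟨hjg, hj⟩)⟩
  refine ⟨z, fun j hj hne => hzJ j (mem_erase.2 ⟨hne, hj⟩), hviol, fun w hw => ?_⟩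
  rw [gval_sub_iff_of_almost I hI hRJ hR y w.1 (disjoint_empty_left _) w.2 hg
    (fun g' hg' hne => hzJ g' (mem_erase.2 ⟨hne, hRJ hg'⟩)) hviol]
  rw [gval_empty]
  exact hzW w hw

include hI hT hRJ hR in
/-- **Every reader is read**: in a minimal infeasible `(J, W)` the second tip of every reader of `R` lies in some constraint of `W`. -/
theorem reader_is_read {W : Finset (Finset (Fin n) × Bool)} (hmin : MinInfeasible I y W J) {g : Fin m} (hg : g ∈ R) :
    ∃ w ∈ W, I.vars g 1 ∈ w.1 := by
  classical
  by_contra hno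
  push Not at hno
  obtain ⟨z, hzJ, -, hzW⟩ := reader_flip I hI hRJ hR y hmin hg
  apply core_not_solvable I hI hT hRJ hR y hmin
  refine ⟨z, fun j hj => hzJ j (mem_sdiff.1 hj).1 (fun h => (mem_sdiff.1 hj).2 (h ▸ hg)), fun w' hw' => ?_⟩
  obtain ⟨w₁, hw₁, rfl⟩ := mem_image.1 hw'
  obtain ⟨w, hw, rfl⟩ := mem_image.1 hw₁
  exact (hzW w hw).2 (hno w hw)

end Core

end Summit.PneNP.PneNP.Theorems.PstarReaderCoreSystem
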